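import Summits.CriticalPhenomena.PercolationContinuityZ3.Theorems.Transplant.FKConnectivityAllQPendantTools
import Summits.CriticalPhenomena.PercolationContinuityZ3.Theorems.Transplant.FKConnectivityAllQSPGluing
import HarnessLib

/-!
# Connectivity correlation inequalities for `φ_{w,q}` — the DOUBLE CONE `K_{2,L}` inside a finite vertex type: weight vector,
# leaf events, and the exact one-leaf TRANSFER identities for `Z`, `S(u ↔ v)` and `S(u ↔ v, leaves not isolated)`

Support file (`--supports stmt-CriticalPhenomena-4575`), census seat `prim-bschramm-census` (gen 21) of the post-continuity
programme; builds on p205010 (kernel theorem, internal audit signed; external expert review pending).  Two definitions (`wK`, `ev`),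
no named facts, no sorries; standard axioms.  Used by `…AllQClusterAssocCex.lean` (the kernel refutation of fk-1 g7's CA node
`ClusterAssocFKPos` on `K_{2,34}`); written for any finite vertex type so that other double-cone certificates (forest / hub / MM
closed forms of bschramm/CENSUS.md §14 item 4) can reuse it.

For hubs `u ≠ v`, a finite set `L` of leaves (off the hubs) and a parameter `p`, `DoubleCone.wK u v p L` puts `p` on the pairs
`s(u,ℓ)`, `s(ℓ,v)` (`ℓ ∈ L`) and `0` elsewhere (Grimmett 2006 (1.20) with edge parameters).  Every leaf `ℓ` is an APEX over
`(u, v)` in the sense of `…AllQApexTools` (its live pairs go to the hubs), and killing its two pairs gives `wK u v p (L ∖ {ℓ})`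
(`wK_insert_update`).  With `Z(L)`, `M(L) = S_L(u ↔ v)` and, for `R ⊆ L`, `N(R, L) = S_L(ev R)`,
`ev R = {u ↔ v} ∩ ⋂_{ℓ ∈ R} (J_{uℓ} ∪ J_{ℓv})`:
* `Z_empty`, `M_empty`: `Z(∅) = q^{|V|}`, `M(∅) = 0`;
* **`Z_insert`**, **`M_insert`** (from fk-1 g5's `apex_mass`, `apex_mass_ab_inter` and `reachable_uv_apex_iff`):
  `Z(L ∪ {ℓ}) = α²·Z(L) − β·M(L)`, `M(L ∪ {ℓ}) = (α² − β − γ)·M(L) + γ·Z(L)` with `α = 1 − p + p q⁻¹`, `β = p² q⁻¹ (q⁻¹ − 1)`,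
  `γ = p² q⁻²` — the 2×2 transfer matrix of one leaf;
* **`N_insert`** (from fk-3's closed-pair split `sum_rcWeightW_ind_compl_openPair_inter`):
  `N(R ∪ {ℓ}, L ∪ {ℓ}) = N(R, L ∪ {ℓ}) − (1 − p)²·N(R, L)`.
[cite: Grimmett2006, §1.4 eq. (1.20) (p. 15); Thm. (3.1)(a) (p. 37)]
-/

noncomputable section

namespace Summit.CriticalPhenomena.PercolationContinuityZ3.Theorems

namespace FK

open MeasureTheory Set Literature.Probability.LatticeModels Literature.Probability.Percolation
open Literature.Probability.Percolation.DecisionTree (ind ind_of_mem ind_of_not_mem)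
open Literature.Probability.Percolation.BHK2006 (weight)
open scoped Classical symmDiff

namespace DoubleCone

/-! ### The weight vector and the leaf events -/

variable {V : Type*} [Fintype V]

/-- The weight vector of the double cone `K_{2,L}` with hubs `u, v`: parameter `p` on the pairs `s(u,ℓ)`, `s(ℓ,v)` (`ℓ ∈ L`),
`0` on every other pair. [cite: Grimmett2006, §1.4 eq. (1.20) (p. 15)] -/
def wK (u v : V) (p : unitInterval) (L : Finset V) : Sym2 V → unitInterval :=
  fun e => if ∃ ℓ ∈ L, e = s(u, ℓ) ∨ e = s(ℓ, v) then p else 0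

/-- The event `{u ↔ v} ∩ ⋂_{ℓ ∈ R} (J_{uℓ} ∪ J_{ℓv})` ("the hubs are joined and no leaf of `R` is isolated"). [folklore] -/
def ev (u v : V) (R : Finset V) : Set (BondConfig V) :=
  (openConn u v : Set (BondConfig V)) ∩ {ω | ∀ ℓ ∈ R, s(u, ℓ) ∈ ω ∨ s(ℓ, v) ∈ ω}

section Structure

variable (u v : V) (p : unitInterval) (q : ℝ)

omit [Fintype V] in
/-- A live pair of `wK` is a leaf pair. [folklore] -/
theorem exists_of_wK_ne_zero {L : Finset V} {e : Sym2 V} (h : ((wK u v p L e : unitInterval) : ℝ) ≠ 0) :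
    ∃ ℓ ∈ L, e = s(u, ℓ) ∨ e = s(ℓ, v) := by
  by_contra hne
  apply h
  unfold wK
  rw [if_neg hne]
  rfl

omit [Fintype V] in
/-- Off the leaf pairs `wK` vanishes. [folklore] -/
theorem wK_eq_zero {L : Finset V} {e : Sym2 V} (hne : ¬ ∃ ℓ ∈ L, e = s(u, ℓ) ∨ e = s(ℓ, v)) :
    ((wK u v p L e : unitInterval) : ℝ) = 0 := by
  unfold wK
  rw [if_neg hne]
  rfl

omit [Fintype V] in
/-- On the leaf pairs `wK` equals `p`. [folklore] -/
theorem wK_apply_left {L : Finset V} {ℓ : V} (hℓ : ℓ ∈ L) : ((wK u v p L s(u, ℓ) : unitInterval) : ℝ) = p := by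
  unfold wK
  rw [if_pos ⟨ℓ, hℓ, Or.inl rfl⟩]

omit [Fintype V] in
/-- On the leaf pairs `wK` equals `p`. [folklore] -/
theorem wK_apply_right {L : Finset V} {ℓ : V} (hℓ : ℓ ∈ L) : ((wK u v p L s(ℓ, v) : unitInterval) : ℝ) = p := by
  unfold wK
  rw [if_pos ⟨ℓ, hℓ, Or.inr rfl⟩]

omit [Fintype V] in
/-- The apex hypothesis of `…AllQApexTools` at every vertex: every live pair contains a hub. [folklore] -/
theorem apex_hyp (L : Finset V) (x : V) :
    ∀ e : Sym2 V, x ∈ e → ((wK u v p L e : unitInterval) : ℝ) ≠ 0 → u ∈ e ∨ v ∈ e := by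
  intro e _ hne
  obtain ⟨ℓ, -, h | h⟩ := exists_of_wK_ne_zero u v p hne <;> subst h
  · exact Or.inl (Sym2.mem_mk_left _ _)
  · exact Or.inr (Sym2.mem_mk_right _ _)

/-- Almost surely every open pair is a leaf pair. [cite: Grimmett2006, §1.4 eq. (1.20) (p. 15)] -/
theorem live_of_mem {L : Finset V} {ω : BondConfig V} (hω : rcWeightW (wK u v p L) q ∅ ω ≠ 0) {e : Sym2 V} (he : e ∈ ω) :
    ∃ ℓ ∈ L, e = s(u, ℓ) ∨ e = s(ℓ, v) := by
  by_contra hne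
  exact not_mem_of_rcWeightW_ne_zero _ q (wK_eq_zero u v p hne) hω he

omit [Fintype V] in
/-- The pairs of a vertex `ℓ ∉ L` off the hubs are dead. [folklore] -/
theorem wK_dead {L : Finset V} {ℓ : V} (hL : ∀ ℓ' ∈ L, ℓ' ≠ u ∧ ℓ' ≠ v) (huv : u ≠ v) (hℓu : ℓ ≠ u)
    (hℓ : ℓ ∉ L) :
    ((wK u v p L s(u, ℓ) : unitInterval) : ℝ) = 0 ∧ ((wK u v p L s(ℓ, v) : unitInterval) : ℝ) = 0 := by
  constructor
  · refine wK_eq_zero u v p ?_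
    rintro ⟨ℓ', hℓ', h | h⟩
    · rw [Sym2.congr_right] at h; exact hℓ (h ▸ hℓ')
    · rcases Sym2.eq_iff.1 h with ⟨h1, _⟩ | ⟨h1, _⟩
      · exact (hL ℓ' hℓ').1 h1.symm
      · exact huv h1
  · refine wK_eq_zero u v p ?_
    rintro ⟨ℓ', hℓ', h | h⟩
    · rcases Sym2.eq_iff.1 h with ⟨h1, _⟩ | ⟨_, h2⟩
      · exact hℓu h1
      · exact huv h2.symm
    · rw [Sym2.congr_left] at h; exact hℓ (h ▸ hℓ')

omit [Fintype V] in
/-- Killing the two pairs of the leaf `ℓ` of `K_{2, L ∪ {ℓ}}` gives `K_{2,L}`. [folklore] -/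
theorem wK_insert_update {L : Finset V} {ℓ : V} (hL : ∀ ℓ' ∈ L, ℓ' ≠ u ∧ ℓ' ≠ v) (huv : u ≠ v) (hℓu : ℓ ≠ u)
    (hℓv : ℓ ≠ v) (hℓ : ℓ ∉ L) :
    Function.update (Function.update (wK u v p (insert ℓ L)) s(u, ℓ) 0) s(ℓ, v) 0 = wK u v p L := by
  funext e
  have hd := wK_dead u v p hL huv hℓu hℓ
  by_cases hb : e = s(ℓ, v)
  · subst hb
    rw [Function.update_self]
    exact Subtype.ext (by rw [hd.2]; rfl)
  rw [Function.update_of_ne hb]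
  by_cases ha : e = s(u, ℓ)
  · subst ha
    rw [Function.update_self]
    exact Subtype.ext (by rw [hd.1]; rfl)
  rw [Function.update_of_ne ha]
  have hiff : (∃ ℓ' ∈ insert ℓ L, e = s(u, ℓ') ∨ e = s(ℓ', v)) ↔ ∃ ℓ' ∈ L, e = s(u, ℓ') ∨ e = s(ℓ', v) := by
    constructor
    · rintro ⟨ℓ', hℓ', h⟩
      rcases Finset.mem_insert.1 hℓ' with rfl | hℓ'L
      · rcases h with h | h
        · exact (ha h).elim
        · exact (hb h).elim
      · exact ⟨ℓ', hℓ'L, h⟩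
    · rintro ⟨ℓ', hℓ', h⟩
      exact ⟨ℓ', Finset.mem_insert_of_mem hℓ', h⟩
  unfold wK
  rw [show (if ∃ ℓ' ∈ insert ℓ L, e = s(u, ℓ') ∨ e = s(ℓ', v) then p else 0) =
      (if ∃ ℓ' ∈ L, e = s(u, ℓ') ∨ e = s(ℓ', v) then p else 0) from if_congr hiff rfl rfl]

/-! ### Masses: bookkeeping -/

/-- `S(Eᶜ) = Z − S(E)`. [cite: Grimmett2006, §1.4 eq. (1.20) (p. 15)] -/
theorem sum_ind_compl (w : Sym2 V → unitInterval) (E : Set (BondConfig V)) :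
    ∑ ω : BondConfig V, rcWeightW w q ∅ ω * ind Eᶜ ω =
      rcPartitionFunctionW w q ∅ - ∑ ω : BondConfig V, rcWeightW w q ∅ ω * ind E ω := by
  rw [← sum_rcWeightW_ind_univ w q, ← Finset.sum_sub_distrib]
  refine Finset.sum_congr rfl fun ω _ => ?_
  by_cases h : ω ∈ E
  · rw [ind_of_mem h, ind_of_mem (Set.mem_univ _), ind_of_not_mem (X := Eᶜ) (fun h' => h' h)]; ring
  · rw [ind_of_not_mem h, ind_of_mem (Set.mem_univ _), ind_of_mem (X := Eᶜ) h]; ring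

/-- `S(E ∩ A) = S(E) − S(Aᶜ ∩ E)`. [cite: Grimmett2006, §1.4 eq. (1.20) (p. 15)] -/
theorem sum_ind_inter_eq_sub (w : Sym2 V → unitInterval) (E A : Set (BondConfig V)) :
    ∑ ω : BondConfig V, rcWeightW w q ∅ ω * ind (E ∩ A) ω =
      ∑ ω : BondConfig V, rcWeightW w q ∅ ω * ind E ω - ∑ ω : BondConfig V, rcWeightW w q ∅ ω * ind (Aᶜ ∩ E) ω := by
  rw [← Finset.sum_sub_distrib]
  refine Finset.sum_congr rfl fun ω _ => ?_
  by_cases hE : ω ∈ E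
  · by_cases hA : ω ∈ A
    · rw [ind_of_mem (X := E ∩ A) ⟨hE, hA⟩, ind_of_mem hE, ind_of_not_mem (X := Aᶜ ∩ E) (fun h => h.1 hA)]; ring
    · rw [ind_of_not_mem (X := E ∩ A) (fun h => hA h.2), ind_of_mem hE, ind_of_mem (X := Aᶜ ∩ E) ⟨hA, hE⟩]; ring
  · rw [ind_of_not_mem (X := E ∩ A) (fun h => hE h.1), ind_of_not_mem hE,
      ind_of_not_mem (X := Aᶜ ∩ E) (fun h => hE h.2)]; ring

/-- Mass of an almost sure disjoint union. [cite: Grimmett2006, §1.4 eq. (1.20) (p. 15)] -/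
theorem sum_ind_eq_add_ae (w : Sym2 V → unitInterval) {E A B : Set (BondConfig V)}
    (h : ∀ ω, rcWeightW w q ∅ ω ≠ 0 → (ω ∈ E ↔ ω ∈ A ∨ ω ∈ B)) (hd : ∀ ω, ω ∈ A → ω ∉ B) :
    ∑ ω : BondConfig V, rcWeightW w q ∅ ω * ind E ω =
      ∑ ω : BondConfig V, rcWeightW w q ∅ ω * ind A ω + ∑ ω : BondConfig V, rcWeightW w q ∅ ω * ind B ω := by
  rw [← Finset.sum_add_distrib]
  refine Finset.sum_congr rfl fun ω _ => ?_
  by_cases hz : rcWeightW w q ∅ ω = 0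
  · rw [hz]; ring
  have hiff := h ω hz
  by_cases hA : ω ∈ A
  · rw [ind_of_mem (hiff.2 (Or.inl hA)), ind_of_mem hA, ind_of_not_mem (hd ω hA)]; ring
  · by_cases hB : ω ∈ B
    · rw [ind_of_mem (hiff.2 (Or.inr hB)), ind_of_not_mem hA, ind_of_mem hB]; ring
    · rw [ind_of_not_mem (fun hE => (hiff.1 hE).elim hA hB), ind_of_not_mem hA, ind_of_not_mem hB]; ring

/-! ### The empty double cone -/

/-- `Z(∅) = q^{|V|}`: with every pair dead only the empty configuration carries weight. [cite: Grimmett2006, §1.4 eq. (1.20) (p. 15)] -/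
theorem Z_empty : rcPartitionFunctionW (wK u v p ∅) q ∅ = q ^ Fintype.card V := by
  have h0 : ∀ e : Sym2 V, ((wK u v p ∅ e : unitInterval) : ℝ) = 0 := fun e => wK_eq_zero u v p (by simp)
  unfold rcPartitionFunctionW
  rw [Finset.sum_eq_single (∅ : BondConfig V)]
  · unfold rcWeightW weight
    rw [clusterCount_empty_card]
    simp [h0]
  · intro ω _ hne
    obtain ⟨e, he⟩ := Set.nonempty_iff_ne_empty.2 hne
    exact rcWeightW_eq_zero_of_zero_mem _ q ∅ (h0 e) he
  · intro h; exact (h (Finset.mem_univ _)).elim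

/-- `M(∅) = 0`: with every pair dead `u ↮ v` almost surely (`u ≠ v`). [cite: Grimmett2006, §1.4 eq. (1.20) (p. 15)] -/
theorem M_empty (huv : u ≠ v) :
    ∑ ω : BondConfig V, rcWeightW (wK u v p ∅) q ∅ ω * ind (openConn u v : Set (BondConfig V)) ω = 0 := by
  refine sum_rcWeightW_ind_eq_zero_ae _ q fun ω hω => ?_
  have hiso : ∀ e ∈ ω, u ∉ e := by
    intro e he _
    obtain ⟨ℓ, hℓ, _⟩ := live_of_mem u v p q hω he
    simp at hℓ
  rw [mem_openConn_iff']
  exact not_reachable_of_isolated hiso huv.symm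

/-! ### One transfer step: removing a leaf -/

/-- `Z(L ∪ {ℓ}) = α²·Z(L) − β·M(L)`. [cite: Grimmett2006, §1.4 eq. (1.20) (p. 15); Thm. (3.1)(a) (p. 37)] -/
theorem Z_insert (hq : q ≠ 0) {L : Finset V} {ℓ : V} (hL : ∀ ℓ' ∈ L, ℓ' ≠ u ∧ ℓ' ≠ v) (huv : u ≠ v)
    (hℓu : ℓ ≠ u) (hℓv : ℓ ≠ v) (hℓ : ℓ ∉ L) :
    rcPartitionFunctionW (wK u v p (insert ℓ L)) q ∅ =
      ((1 - (p : ℝ)) + (p : ℝ) * q⁻¹) * ((1 - (p : ℝ)) + (p : ℝ) * q⁻¹) * rcPartitionFunctionW (wK u v p L) q ∅ -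
        (p : ℝ) * (p : ℝ) * q⁻¹ * (q⁻¹ - 1) *
          ∑ ω : BondConfig V, rcWeightW (wK u v p L) q ∅ ω * ind (openConn u v : Set (BondConfig V)) ω := by
  set w := wK u v p (insert ℓ L) with hw
  have hwa : ((w s(u, ℓ) : unitInterval) : ℝ) = p := wK_apply_left u v p (Finset.mem_insert_self ℓ L)
  have hwb : ((w s(ℓ, v) : unitInterval) : ℝ) = p := wK_apply_right u v p (Finset.mem_insert_self ℓ L)
  have hup := wK_insert_update u v p hL huv hℓu hℓv hℓ
  have hd := wK_dead u v p hL huv hℓu hℓ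
  set K : Set (BondConfig V) := {ω : BondConfig V | ω \ {s(u, ℓ), s(ℓ, v)} ∈ (openConn u v : Set (BondConfig V))} with hK
  have key := apex_mass w hq hℓu hℓv huv (apex_hyp u v p (insert ℓ L) ℓ) Set.univ (fun ω => by simp) (fun ω => by simp)
  rw [sum_rcWeightW_ind_univ, hup, sum_rcWeightW_ind_univ, Set.univ_inter, hwa, hwb] at key
  have hKM : ∑ ω : BondConfig V, rcWeightW (wK u v p L) q ∅ ω * ind K ω =
      ∑ ω : BondConfig V, rcWeightW (wK u v p L) q ∅ ω * ind (openConn u v : Set (BondConfig V)) ω := by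
    refine sum_rcWeightW_ind_congr_ae _ q fun ω hω => ?_
    have ha : s(u, ℓ) ∉ ω := not_mem_of_rcWeightW_ne_zero _ q hd.1 hω
    have hb : s(ℓ, v) ∉ ω := not_mem_of_rcWeightW_ne_zero _ q hd.2 hω
    have hωeq : ω \ {s(u, ℓ), s(ℓ, v)} = ω := by
      ext e
      simp only [Set.mem_sdiff, Set.mem_insert_iff, Set.mem_singleton_iff]
      constructor
      · exact fun h => h.1
      · intro he
        refine ⟨he, ?_⟩
        rintro (rfl | rfl)
        · exact ha he
        · exact hb he
    simp only [hK, Set.mem_setOf_eq, hωeq]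
  rw [hKM] at key
  rw [key]

/-- `M(L ∪ {ℓ}) = (α² − β − γ)·M(L) + γ·Z(L)`. [cite: Grimmett2006, §1.4 eq. (1.20) (p. 15); Thm. (3.1)(a) (p. 37)] -/
theorem M_insert (hq : q ≠ 0) {L : Finset V} {ℓ : V} (hL : ∀ ℓ' ∈ L, ℓ' ≠ u ∧ ℓ' ≠ v) (huv : u ≠ v)
    (hℓu : ℓ ≠ u) (hℓv : ℓ ≠ v) (hℓ : ℓ ∉ L) :
    ∑ ω : BondConfig V, rcWeightW (wK u v p (insert ℓ L)) q ∅ ω * ind (openConn u v : Set (BondConfig V)) ω =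
      (((1 - (p : ℝ)) + (p : ℝ) * q⁻¹) * ((1 - (p : ℝ)) + (p : ℝ) * q⁻¹) - (p : ℝ) * (p : ℝ) * q⁻¹ * (q⁻¹ - 1) -
          (p : ℝ) * (p : ℝ) * q⁻¹ * q⁻¹) *
          ∑ ω : BondConfig V, rcWeightW (wK u v p L) q ∅ ω * ind (openConn u v : Set (BondConfig V)) ω +
        (p : ℝ) * (p : ℝ) * q⁻¹ * q⁻¹ * rcPartitionFunctionW (wK u v p L) q ∅ := by
  set w := wK u v p (insert ℓ L) with hw
  have hwa : ((w s(u, ℓ) : unitInterval) : ℝ) = p := wK_apply_left u v p (Finset.mem_insert_self ℓ L)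
  have hwb : ((w s(ℓ, v) : unitInterval) : ℝ) = p := wK_apply_right u v p (Finset.mem_insert_self ℓ L)
  have hup := wK_insert_update u v p hL huv hℓu hℓv hℓ
  have hd := wK_dead u v p hL huv hℓu hℓ
  have hhyp := apex_hyp u v p (insert ℓ L) ℓ
  set K : Set (BondConfig V) := {ω : BondConfig V | ω \ {s(u, ℓ), s(ℓ, v)} ∈ (openConn u v : Set (BondConfig V))} with hK
  -- a.s. under `wK L` the apex pairs are closed, so `K = {u ↔ v}`
  have hKiff : ∀ ω, rcWeightW (wK u v p L) q ∅ ω ≠ 0 → (ω ∈ K ↔ ω ∈ (openConn u v : Set (BondConfig V))) := by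
    intro ω hω
    have ha : s(u, ℓ) ∉ ω := not_mem_of_rcWeightW_ne_zero _ q hd.1 hω
    have hb : s(ℓ, v) ∉ ω := not_mem_of_rcWeightW_ne_zero _ q hd.2 hω
    have hωeq : ω \ {s(u, ℓ), s(ℓ, v)} = ω := by
      ext e
      simp only [Set.mem_sdiff, Set.mem_insert_iff, Set.mem_singleton_iff]
      constructor
      · exact fun h => h.1
      · intro he
        refine ⟨he, ?_⟩
        rintro (rfl | rfl)
        · exact ha he
        · exact hb he
    simp only [hK, Set.mem_setOf_eq, hωeq]
  have hKM : ∑ ω : BondConfig V, rcWeightW (wK u v p L) q ∅ ω * ind K ω =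
      ∑ ω : BondConfig V, rcWeightW (wK u v p L) q ∅ ω * ind (openConn u v : Set (BondConfig V)) ω :=
    sum_rcWeightW_ind_congr_ae _ q hKiff
  have hKcM : ∑ ω : BondConfig V, rcWeightW (wK u v p L) q ∅ ω * ind Kᶜ ω =
      rcPartitionFunctionW (wK u v p L) q ∅ -
        ∑ ω : BondConfig V, rcWeightW (wK u v p L) q ∅ ω * ind (openConn u v : Set (BondConfig V)) ω := by
    rw [← hKM]; exact sum_ind_compl q _ K
  -- split `{u ↔ v} = K ⊔ (J_a ∩ J_b ∩ Kᶜ)` almost surely under `w`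
  have hsplit : ∑ ω : BondConfig V, rcWeightW w q ∅ ω * ind (openConn u v : Set (BondConfig V)) ω =
      ∑ ω : BondConfig V, rcWeightW w q ∅ ω * ind K ω +
        ∑ ω : BondConfig V, rcWeightW w q ∅ ω * ind ({ω | s(u, ℓ) ∈ ω} ∩ ({ω | s(ℓ, v) ∈ ω} ∩ Kᶜ)) ω := by
    refine sum_ind_eq_add_ae q w (fun ω hω => ?_) (fun ω hωK hω2 => hω2.2.2 hωK)
    have hapex := apex_of_rcWeightW_ne_zero w q hℓu hℓv hhyp hω
    rw [mem_openConn_iff', reachable_uv_apex_iff hℓu hℓv hapex]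
    simp only [hK, Set.mem_setOf_eq, Set.mem_inter_iff, Set.mem_compl_iff, mem_openConn_iff']
    tauto
  have h1 := apex_mass w hq hℓu hℓv huv hhyp K (apexAvoid_insens u v ℓ (Or.inl rfl)) (apexAvoid_insens u v ℓ (Or.inr rfl))
  have h2 := apex_mass_ab_inter w hq hℓu hℓv huv hhyp Kᶜ (apexAvoid_compl_insens u v ℓ (Or.inl rfl))
    (apexAvoid_compl_insens u v ℓ (Or.inr rfl))
  rw [hup, hwa, hwb, Set.inter_self] at h1
  rw [hup, hwa, hwb, Set.inter_self] at h2
  rw [hsplit, h1, h2, hKM, hKcM]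
  ring

/-- The leaf recursion for the events: `N(R ∪ {ℓ}, L) = N(R, L) − (1−p)²·N(R, L ∖ {ℓ})` (`ℓ ∈ L ∖ R`), written for
`L = L' ∪ {ℓ}`. [cite: Grimmett2006, §1.4 eq. (1.20) (p. 15); Thm. (3.1)(a) (p. 37)] -/
theorem N_insert {L : Finset V} {ℓ : V} (hL : ∀ ℓ' ∈ L, ℓ' ≠ u ∧ ℓ' ≠ v) (huv : u ≠ v) (hℓu : ℓ ≠ u) (hℓv : ℓ ≠ v)
    (hℓ : ℓ ∉ L) (R : Finset V) :
    ∑ ω : BondConfig V, rcWeightW (wK u v p (insert ℓ L)) q ∅ ω * ind (ev u v (insert ℓ R)) ω =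
      ∑ ω : BondConfig V, rcWeightW (wK u v p (insert ℓ L)) q ∅ ω * ind (ev u v R) ω -
        (1 - (p : ℝ)) * (1 - (p : ℝ)) * ∑ ω : BondConfig V, rcWeightW (wK u v p L) q ∅ ω * ind (ev u v R) ω := by
  set w := wK u v p (insert ℓ L) with hw
  have hwa : ((w s(u, ℓ) : unitInterval) : ℝ) = p := wK_apply_left u v p (Finset.mem_insert_self ℓ L)
  have hwb : ((w s(ℓ, v) : unitInterval) : ℝ) = p := wK_apply_right u v p (Finset.mem_insert_self ℓ L)
  have hab : s(u, ℓ) ≠ s(ℓ, v) := apex_pairs_ne hℓu huv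
  have hup := wK_insert_update u v p hL huv hℓu hℓv hℓ
  have hev : ev u v (insert ℓ R) = ev u v R ∩ {ω | s(u, ℓ) ∈ ω ∨ s(ℓ, v) ∈ ω} := by
    ext ω
    simp only [ev, Set.mem_inter_iff, Set.mem_setOf_eq, Finset.forall_mem_insert]
    tauto
  have hc : ({ω : BondConfig V | s(u, ℓ) ∈ ω ∨ s(ℓ, v) ∈ ω}ᶜ ∩ ev u v R) =
      {ω | s(u, ℓ) ∈ ω}ᶜ ∩ ({ω | s(ℓ, v) ∈ ω}ᶜ ∩ ev u v R) := by
    ext ω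
    simp only [Set.mem_inter_iff, Set.mem_compl_iff, Set.mem_setOf_eq, not_or]
    tauto
  rw [hev, sum_ind_inter_eq_sub q w, hc, sum_rcWeightW_ind_compl_openPair_inter w q,
    sum_rcWeightW_ind_compl_openPair_inter (Function.update w s(u, ℓ) 0) q, Function.update_of_ne hab.symm, hup, hwa, hwb]
  ring

end Structure

end DoubleCone

end FK

end Summit.CriticalPhenomena.PercolationContinuityZ3.Theorems

end
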